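/-
Copyright (c) 2026 the pub-hodgecm-mathlib formalisation cell (harness21).  Prover seat hodgecm-mathlib-K2E1-p12 (g2), Track B ∕ K2-LIT, h413 =
`stmt-HodgeConjecture-24833`, line `K2_E1_TraceFormulaBeta`, (137)∕P4 «N = 2 RES-chain print», part 3b — the `N = 2` twin (`U(1,1)_{L/L⁺}`, pole `1`, tube `1 < Re z`) of ★ p859641
`K2E1SphericalEisensteinResidueOrthogonalCMThree` (K2E4-p10 (g6)): the letter `horth` of ★ `hres_cm_two_of_letters` — the residue class `Res_T + κ·[𝟙_{T<w₁}]` is orthogonal to every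
cusp form (dealer K2E1-plan (g7) (137)∕(182), 2026-09-04).
-/
import Summits.HodgeConjecture.HodgeConjecture.Theorems.K2E1TruncatedEisensteinCuspOrthogonalCMTwo   -- THIS SEAT (part 3a): `⟪φ̂, [Λ^T E(φ₀H^z)]⟫ = 0` on the tube `1 < Re z`; brings the generic part (§1 Hilbert, §2 Siegel indicator), ★ FILE A∕B, (β1), the CM discharges
import HarnessLib

/-!
# K2·E1 — `K2E1SphericalEisensteinResidueOrthogonalCMTwo` ((137)∕P4 part 3b = (P-orth)₂ at `U(1,1)_{L/L⁺}`): THE LETTER `horth` OF ★ `hres_cm_two_of_letters` — THE RESIDUE CLASS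
# `Res_T + κ·[𝟙_{T<w₁}]` IS ORTHOGONAL TO EVERY CUSP FORM

Track B ∕ K2-LIT, crux h413 = `stmt-HodgeConjecture-24833`, route of record `HCCMUnconditional`; cell `hodgecm-mathlib`, squad K2, ENGINE E1.  Prover seat `hodgecm-mathlib-K2E1-p12` (g2);
deal (137)∕P4 of the dealer K2E1-plan (g7) (5-file letter-free `N = 2` RES-chain road, «=» (182)∕(189)).  THEOREMS ONLY (no `def`, no `instance`, no notation, no named-fact hypothesis, no
`sorry`); lane `--supports stmt-HodgeConjecture-24833 --as helper` (count-neutral).  Closes no socket.  The byte-for-byte `N = 2` twin of ★ `K2E1SphericalEisensteinResidueOrthogonalCMThree`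
with `3 ↦ 2`, pole `2 ↦ 1`, tube `2 < Re z ↦ 1 < Re z` (binder `hD2 ↦ hD1`), every `N = 3` input replaced by its ★ `N = 2` twin.

THE MATHEMATICS ([MoeglinWaldspurger1995, IV.1.11 with II.1.8 and I.2.13]; [BernsteinLapid2019, §4 Claim 2]).  On the Godement tube `1 < Re z` the truncated Eisenstein series splits as
`Λ^T E(f_z) = E(𝟙_{H≤T} f_z) − E(𝟙_{H>T} φ₀ c(z) H^{1−z})` (★ `truncation_eisensteinSeriesU_eq_two`, the constant term ★ `borelConstantTerm_sphericalEisenstein_cm_two`), two Eisenstein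
series of Borel left-`N(𝔸)B(L⁺)`-invariant functions whose majorant series are controlled, so ★ FILE A («`E(f) ⊥ Λ` when `Λ_B ≡ 0`», `K2E1BLEisensteinCuspOrthogonalU`) applies to both
against the lift `Λ = invQuot φ` of a cusp form (★ (β1)): `⟪φ̂, v⟫ = 0` for every `L²` class `v =ᵐ Λ^T E(f_z)` (★ part 3a `K2E1TruncatedEisensteinCuspOrthogonalCMTwo`).  The Siegel indicator
class `[𝟙_{T<w₁}] = [E(𝟙_{H>T})]` (★ generic §2) is orthogonal to cusp forms by the same FILE A (§1).  §2 THE HEAD: for the operator road's holomorphic family `F : D → L²(μ)` with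
`F z =ᵐ Λ^T Ẽ(z)` (`D` open preconnected, containing a punctured neighbourhood of `1` and a neighbourhood of a real tube point `σ₀ > 1`, `Ẽ = E` on the tube), `z ↦ ⟪φ̂, F z⟫` vanishes near
`σ₀` (§1), hence on `D` (identity principle ★ generic §1), hence `⟪φ̂, (z−1)•F z + κ•[𝟙_{T<w₁}]⟫ = 0` near `1` and in the limit **`⟪Res + κ•[𝟙_{T<w₁}], φ̂⟫ = 0`** — EXACTLY the letter
`horth` of ★ `K2E1SphericalEisensteinRegularRemainderCMTwoOfLetters.hres_cm_two_of_letters` with `Fres := Res + κ • ind`.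
HONEST LABEL: HC_CM is proved only modulo the 7 printed citations (2 remaining named inputs: hLiu418 = `stmt-HodgeConjecture-24832`, h413 = `stmt-HodgeConjecture-24833`) until rung 0
closes; this file asserts no named fact and closes no socket; the head is CONDITIONAL on the operator road's letters `(F, hFd, hFam)`, EXPORTS₂ `(Ec, D, hE2)` and the residue letter `hRes`.
References: [MoeglinWaldspurger1995] I.2.13, II.1.8, IV.1.11 · [BernsteinLapid2019] §4 p. 10 · [Garrett2018] §2.10–§2.11 · [BorelJacquet1979] §4.4–§4.6.
-/

set_option autoImplicit false
-- the mandated namespace repeats the single-problem summit's segment (`HodgeConjecture.HodgeConjecture`)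
set_option linter.dupNamespace false

noncomputable section

open MeasureTheory Measure NumberField IsDedekindDomain Set Filter Topology MulAction
open scoped ENNReal NNReal InnerProductSpace ComplexConjugate
open Literature.MeasureTheory.Group Literature.NumberTheory
open Literature.NumberTheory.Automorphic Literature.NumberTheory.Automorphic.UnitaryGroup AdelicGroupData
open Summit.HodgeConjecture.HodgeConjecture.Cruxes.H413.K2E1BorelEisensteinU
open Summit.HodgeConjecture.HodgeConjecture.Cruxes.H413.K2E1BorelCosetsDictionary (eisensteinSeriesU_eq_tsum_arithmeticBorelQuot)
open Summit.HodgeConjecture.HodgeConjecture.Cruxes.H413.K2E1TruncatedEisensteinExplicit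
open Summit.HodgeConjecture.HodgeConjecture.Cruxes.H413.K2E1BLEisensteinCuspOrthogonalU
open Summit.HodgeConjecture.HodgeConjecture.Cruxes.H413.K2E1BLEisensteinInWeightedSpaceU2 (lintegral_weight_enorm_mul_lt_top_of_lintegral_quotient_lt_top exists_isCoveringWeight_arithmeticBorel)
open Summit.HodgeConjecture.HodgeConjecture.Cruxes.H413.K2E1CuspConditionDictionaryU (invQuot_package_of_mem_cuspForms)
open Summit.HodgeConjecture.HodgeConjecture.Cruxes.H413.K2E1SphericalHeckeEigenSectionU2 (norm_borelHeight_cpow continuous_borelHeight_cpow borelHeight_coe_pos)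
open Summit.HodgeConjecture.HodgeConjecture.Cruxes.H413.K2E1BLBorelSpacesU2Defs
open Summit.HodgeConjecture.HodgeConjecture.Cruxes.H413.K2E1SphericalEisensteinResidueOrthogonalU
open Summit.HodgeConjecture.HodgeConjecture.Cruxes.H413.K2E1TruncatedEisensteinCuspOrthogonalCMTwo

namespace Summit.HodgeConjecture.HodgeConjecture.Cruxes.H413.K2E1SphericalEisensteinResidueOrthogonalCMTwo

variable (L : Type) [Field L] [NumberField L] [IsCMField L]
variable [MeasurableSpace (quasiSplit (↥(maximalRealSubfield L)) L (IsCMField.complexConj L) 2).Adelic] [BorelSpace (quasiSplit (↥(maximalRealSubfield L)) L (IsCMField.complexConj L) 2).Adelic]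


/-! ## §1 The Siegel indicator class is orthogonal to every cusp form -/

section Indicator

variable (μ : Measure (quasiSplit (↥(maximalRealSubfield L)) L (IsCMField.complexConj L) 2).automorphicQuotient) [(quasiSplit (↥(maximalRealSubfield L)) L (IsCMField.complexConj L) 2).IsAutomorphicMeasure μ]

/-- **`⟪φ̂, [𝟙_{T<w₁}]⟫ = 0`**: the Siegel indicator class (`v =ᵐ quotFun (t ↦ 𝟙[T < w₁[t⁻¹]])`, `T ≥ 1`) is orthogonal to every cusp form — it is the Eisenstein series `E(𝟙_{H>T})` (★
generic §2), and ★ FILE A applies with the trivial `L¹` letter (one coset above the floor). [cite: MoeglinWaldspurger1995, I.2.13, II.1.8] -/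
theorem inner_cuspFormsToLp_eq_zero_of_ae_eq_siegelIndicator_cm_two
    (ν : Measure ↥(adelicUnipotent (↥(maximalRealSubfield L)) L (IsCMField.complexConj L) 2)) [ν.IsHaarMeasure]
    {𝓕 : Set ↥(adelicUnipotent (↥(maximalRealSubfield L)) L (IsCMField.complexConj L) 2)}
    (h𝓕N : IsFundamentalDomain ↥(rationalUnipotent (↥(maximalRealSubfield L)) L (IsCMField.complexConj L) 2) 𝓕 ν) (h𝓕c : IsCompact (closure 𝓕))
    (𝔓 : (quasiSplit (↥(maximalRealSubfield L)) L (IsCMField.complexConj L) 2).ParabolicUnipotentData) (i : 𝔓.ι)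
    (h𝔓 : 𝔓.radical i = adelicUnipotent (↥(maximalRealSubfield L)) L (IsCMField.complexConj L) 2) {T : ℝ≥0} (hT : 1 ≤ T)
    (v : (quasiSplit (↥(maximalRealSubfield L)) L (IsCMField.complexConj L) 2).L2 μ)
    (hv : (v : (quasiSplit (↥(maximalRealSubfield L)) L (IsCMField.complexConj L) 2).automorphicQuotient → ℂ) =ᵐ[μ]
      (quasiSplit (↥(maximalRealSubfield L)) L (IsCMField.complexConj L) 2).quotFun fun t =>
        if T < supHeight (↥(maximalRealSubfield L)) L (IsCMField.complexConj L) 2 ((quasiSplit (↥(maximalRealSubfield L)) L (IsCMField.complexConj L) 2).toAutomorphicQuotient t⁻¹) then (1 : ℂ) else 0)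
    (φ : ↥((quasiSplit (↥(maximalRealSubfield L)) L (IsCMField.complexConj L) 2).cuspForms μ 𝔓)) :
    ⟪(quasiSplit (↥(maximalRealSubfield L)) L (IsCMField.complexConj L) 2).cuspFormsToLp μ 𝔓 φ, v⟫_ℂ = 0 := by
  haveI := t2Space_adeleRing_of_numberField L
  haveI := locallyCompactSpace_adeleRing' L
  haveI := secondCountableTopology_adeleRing L
  haveI : T2Space (quasiSplit (↥(maximalRealSubfield L)) L (IsCMField.complexConj L) 2).Adelic :=
    inferInstanceAs (T2Space (adelic (↥(maximalRealSubfield L)) L (IsCMField.complexConj L) 2 ((StdForm.antidiagonal 2).over L)))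
  haveI : LocallyCompactSpace (quasiSplit (↥(maximalRealSubfield L)) L (IsCMField.complexConj L) 2).Adelic :=
    inferInstanceAs (LocallyCompactSpace (adelic (↥(maximalRealSubfield L)) L (IsCMField.complexConj L) 2 ((StdForm.antidiagonal 2).over L)))
  haveI : SecondCountableTopology (quasiSplit (↥(maximalRealSubfield L)) L (IsCMField.complexConj L) 2).Adelic :=
    inferInstanceAs (SecondCountableTopology (adelic (↥(maximalRealSubfield L)) L (IsCMField.complexConj L) 2 ((StdForm.antidiagonal 2).over L)))
  have hc : (IsCMField.complexConj L) * (IsCMField.complexConj L) = 1 := AlgEquiv.ext fun x => IsCMField.complexConj_apply_apply L x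
  have hc1 : (IsCMField.complexConj L) ≠ 1 := IsCMField.complexConj_ne_one L
  haveI : (haar : Measure (quasiSplit (↥(maximalRealSubfield L)) L (IsCMField.complexConj L) 2).Adelic).IsMulRightInvariant :=
    forall_isHaarMeasure_isMulRightInvariant_quasiSplit_cm L (le_refl 2) haar inferInstance
  haveI : (haar : Measure (quasiSplit (↥(maximalRealSubfield L)) L (IsCMField.complexConj L) 2).Adelic).IsInvInvariant := isInvInvariant_of_isMulRightInvariant _
  haveI : ν.IsInvInvariant := K2E1UnipotentHaarNormalisationU2.isInvInvariant_of_isHaarMeasure_two ν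
  have h𝓕₀ : ν 𝓕 ≠ 0 := measure_ne_zero_of_isFundamentalDomain_rationalUnipotent ν h𝓕N
  have h𝓕top : ν 𝓕 ≠ ∞ := ((measure_mono subset_closure).trans_lt h𝓕c.measure_lt_top).ne
  obtain ⟨β, hβ⟩ := exists_isCoveringWeight_arithmeticBorel (F := (↥(maximalRealSubfield L))) (E := L) (c := (IsCMField.complexConj L)) (N := 2)
  -- the cut-off `𝟙_{H>T}`
  set fT : (quasiSplit (↥(maximalRealSubfield L)) L (IsCMField.complexConj L) 2).Adelic → ℂ :=
    {g : (quasiSplit (↥(maximalRealSubfield L)) L (IsCMField.complexConj L) 2).Adelic | T < borelHeight g}.indicator (fun _ => (1 : ℂ)) with hfT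
  have hsm : MeasurableSet {g : (quasiSplit (↥(maximalRealSubfield L)) L (IsCMField.complexConj L) 2).Adelic | T < borelHeight g} :=
    measurableSet_lt measurable_const continuous_borelHeight.measurable
  have hfm : Measurable fT := measurable_const.indicator hsm
  have h1B : ∀ b ∈ arithmeticBorel (↥(maximalRealSubfield L)) L (IsCMField.complexConj L) 2, ∀ x : (quasiSplit (↥(maximalRealSubfield L)) L (IsCMField.complexConj L) 2).Adelic,
      (fun _ : (quasiSplit (↥(maximalRealSubfield L)) L (IsCMField.complexConj L) 2).Adelic => (1 : ℂ)) ((b : (quasiSplit (↥(maximalRealSubfield L)) L (IsCMField.complexConj L) 2).Adelic) * x) =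
        (fun _ : (quasiSplit (↥(maximalRealSubfield L)) L (IsCMField.complexConj L) 2).Adelic => (1 : ℂ)) x := fun _ _ _ => rfl
  have hfB := forall_arithmeticBorel_indicator (ψ := fun _ : (quasiSplit (↥(maximalRealSubfield L)) L (IsCMField.complexConj L) 2).Adelic => (1 : ℂ)) h1B fun h => T < h
  have hfN : ∀ (u : ↥(adelicUnipotent (↥(maximalRealSubfield L)) L (IsCMField.complexConj L) 2)) (g : (quasiSplit (↥(maximalRealSubfield L)) L (IsCMField.complexConj L) 2).Adelic),
      fT ((u : (quasiSplit (↥(maximalRealSubfield L)) L (IsCMField.complexConj L) 2).Adelic) * g) = fT g := fun u g => by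
    simp only [hfT, Set.indicator_apply, Set.mem_setOf_eq, borelHeight_unipotent_mul u.2]
  obtain ⟨hΛm, hΛinv, hΛq, hΛB⟩ := invQuot_package_of_mem_cuspForms 𝔓 i h𝔓 ν h𝓕N φ.2
  have hΛG : ∀ (γ : (quasiSplit (↥(maximalRealSubfield L)) L (IsCMField.complexConj L) 2).arithmeticSubgroup) (x : (quasiSplit (↥(maximalRealSubfield L)) L (IsCMField.complexConj L) 2).Adelic),
      invQuot (quasiSplit (↥(maximalRealSubfield L)) L (IsCMField.complexConj L) 2) (φ : (quasiSplit (↥(maximalRealSubfield L)) L (IsCMField.complexConj L) 2).automorphicQuotient → ℂ)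
        ((γ : (quasiSplit (↥(maximalRealSubfield L)) L (IsCMField.complexConj L) 2).Adelic) * x) =
      invQuot (quasiSplit (↥(maximalRealSubfield L)) L (IsCMField.complexConj L) 2) (φ : (quasiSplit (↥(maximalRealSubfield L)) L (IsCMField.complexConj L) 2).automorphicQuotient → ℂ) x :=
    fun γ x => hΛinv _ ((quasiSplit (↥(maximalRealSubfield L)) L (IsCMField.complexConj L) 2).arithmeticSubgroup_le_quotientSubgroup γ.2) x
  have hq : ∀ x : (quasiSplit (↥(maximalRealSubfield L)) L (IsCMField.complexConj L) 2).automorphicQuotient,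
      invQuot (quasiSplit (↥(maximalRealSubfield L)) L (IsCMField.complexConj L) 2) (φ : (quasiSplit (↥(maximalRealSubfield L)) L (IsCMField.complexConj L) 2).automorphicQuotient → ℂ)
        (Quotient.out (x : (quasiSplit (↥(maximalRealSubfield L)) L (IsCMField.complexConj L) 2).Adelic ⧸ (quasiSplit (↥(maximalRealSubfield L)) L (IsCMField.complexConj L) 2).quotientSubgroup))⁻¹ =
      (φ : (quasiSplit (↥(maximalRealSubfield L)) L (IsCMField.complexConj L) 2).automorphicQuotient → ℂ) x := fun x => congrFun hΛq x
  have hφ2 : MemLp (φ : (quasiSplit (↥(maximalRealSubfield L)) L (IsCMField.complexConj L) 2).automorphicQuotient → ℂ) 2 μ := AdelicGroupData.memLp_of_mem_cuspForms φ.2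
  have hφ1 : Integrable (φ : (quasiSplit (↥(maximalRealSubfield L)) L (IsCMField.complexConj L) 2).automorphicQuotient → ℂ) μ := hφ2.integrable one_le_two
  have hL1 : ∫⁻ g, β g * ‖fT g * conj (invQuot (quasiSplit (↥(maximalRealSubfield L)) L (IsCMField.complexConj L) 2)
      (φ : (quasiSplit (↥(maximalRealSubfield L)) L (IsCMField.complexConj L) 2).automorphicQuotient → ℂ) g)‖ₑ ∂haar < ∞ := by
    refine lintegral_weight_enorm_mul_lt_top_of_lintegral_quotient_lt_top μ haar hβ hfm hΛm hfB hΛG ?_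
    calc ∫⁻ x : (quasiSplit (↥(maximalRealSubfield L)) L (IsCMField.complexConj L) 2).automorphicQuotient,
          (∑' q : Quotient (QuotientGroup.rightRel (arithmeticBorel (↥(maximalRealSubfield L)) L (IsCMField.complexConj L) 2)),
            ‖fT (((q.out : (quasiSplit (↥(maximalRealSubfield L)) L (IsCMField.complexConj L) 2).arithmeticSubgroup) : (quasiSplit (↥(maximalRealSubfield L)) L (IsCMField.complexConj L) 2).Adelic) *
              (Quotient.out x : (quasiSplit (↥(maximalRealSubfield L)) L (IsCMField.complexConj L) 2).Adelic)⁻¹)‖ₑ) *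
            ‖invQuot (quasiSplit (↥(maximalRealSubfield L)) L (IsCMField.complexConj L) 2) (φ : (quasiSplit (↥(maximalRealSubfield L)) L (IsCMField.complexConj L) 2).automorphicQuotient → ℂ)
              (Quotient.out x : (quasiSplit (↥(maximalRealSubfield L)) L (IsCMField.complexConj L) 2).Adelic)⁻¹‖ₑ ∂μ
        ≤ ∫⁻ x, ENNReal.ofReal 1 * ‖(φ : (quasiSplit (↥(maximalRealSubfield L)) L (IsCMField.complexConj L) 2).automorphicQuotient → ℂ) x‖ₑ ∂μ :=
          lintegral_mono fun x => by
            rw [hq x]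
            exact mul_le_mul' (tsum_enorm_indicator_lt_le siegel_two hT zero_le_one (fun g _ => by rw [norm_one]) _) le_rfl
      _ < ∞ := by
          rw [lintegral_const_mul' _ _ ENNReal.ofReal_ne_top]
          exact ENNReal.mul_lt_top ENNReal.ofReal_lt_top hφ1.2
  have h0 := integral_quotFun_eisensteinSeriesU_mul_conj_eq_zero_two hc hc1 μ haar ν h𝓕N h𝓕₀ h𝓕top hβ hfm hΛm hfN hfB hΛG hL1 (ae_of_all _ hΛB)
  rw [hΛq, quotFun_eisensteinSeriesU_indicator_one siegel_two hT] at h0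
  rw [AdelicGroupData.cuspFormsToLp_apply, MeasureTheory.L2.inner_def]
  have hae : (fun x : (quasiSplit (↥(maximalRealSubfield L)) L (IsCMField.complexConj L) 2).automorphicQuotient =>
      ⟪(hφ2.toLp (φ : (quasiSplit (↥(maximalRealSubfield L)) L (IsCMField.complexConj L) 2).automorphicQuotient → ℂ)) x, v x⟫_ℂ) =ᵐ[μ]
      fun x => (quasiSplit (↥(maximalRealSubfield L)) L (IsCMField.complexConj L) 2).quotFun (fun t =>
          if T < supHeight (↥(maximalRealSubfield L)) L (IsCMField.complexConj L) 2 ((quasiSplit (↥(maximalRealSubfield L)) L (IsCMField.complexConj L) 2).toAutomorphicQuotient t⁻¹) then (1 : ℂ) else 0) x *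
        conj ((φ : (quasiSplit (↥(maximalRealSubfield L)) L (IsCMField.complexConj L) 2).automorphicQuotient → ℂ) x) := by
    filter_upwards [hφ2.coeFn_toLp, hv] with x hx hvx
    rw [hx, hvx, RCLike.inner_apply]
  rw [integral_congr_ae hae, h0]


end Indicator

/-! ## §2 The head: the letter `horth` of ★ `hres_cm_two_of_letters` -/

section Head

variable (μ : Measure (quasiSplit (↥(maximalRealSubfield L)) L (IsCMField.complexConj L) 2).automorphicQuotient) [(quasiSplit (↥(maximalRealSubfield L)) L (IsCMField.complexConj L) 2).IsAutomorphicMeasure μ]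

/-- **(P-orth)₂ — THE LETTER `horth` OF ★ `hres_cm_two_of_letters`.**  DATA: `ν` Haar on `N(𝔸)` with a fundamental domain `𝓕` of compact closure; parabolic data `𝔓` with `𝔓.radical i =
N(𝔸)`; `φ₀`; `T ≥ 1`; the continued Eisenstein values `Ec` on an open preconnected `D ⊆ ℂ` containing a punctured neighbourhood of `1` and a neighbourhood of a real tube point `σ₀ > 1`, with
`Ec z = E(φ₀H^z)` on `D ∩ {1 < re}` ((E2)); the operator road's family `F : ℂ → L²(μ)`, holomorphic on `D`, with `F z =ᵐ Λ^T(Ec z)` on `D`; its residue class `Res = lim_{z→1} (z−1)•F z`; the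
Siegel indicator class `ind = [𝟙_{T<w₁}]`; `κ : ℂ`.  CONCLUSION: **`⟪Res + κ • ind, φ̂⟫ = 0` for every `φ ∈ cuspForms μ 𝔓`** — ★ `hres_cm_two_of_letters`'s `horth` with `Fres := Res + κ • ind`.
[cite: MoeglinWaldspurger1995, IV.1.11] [cite: BernsteinLapid2019, §4 Claim 2] -/
theorem horth_cm_two_of_letters
    (ν : Measure ↥(adelicUnipotent (↥(maximalRealSubfield L)) L (IsCMField.complexConj L) 2)) [ν.IsHaarMeasure]
    {𝓕 : Set ↥(adelicUnipotent (↥(maximalRealSubfield L)) L (IsCMField.complexConj L) 2)}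
    (h𝓕N : IsFundamentalDomain ↥(rationalUnipotent (↥(maximalRealSubfield L)) L (IsCMField.complexConj L) 2) 𝓕 ν) (h𝓕c : IsCompact (closure 𝓕))
    (𝔓 : (quasiSplit (↥(maximalRealSubfield L)) L (IsCMField.complexConj L) 2).ParabolicUnipotentData) (i : 𝔓.ι)
    (h𝔓 : 𝔓.radical i = adelicUnipotent (↥(maximalRealSubfield L)) L (IsCMField.complexConj L) 2)
    (φ₀ : ℂ) {T : ℝ≥0} (hT : 1 ≤ T)
    (Ec : ℂ → (quasiSplit (↥(maximalRealSubfield L)) L (IsCMField.complexConj L) 2).Adelic → ℂ) {D : Set ℂ} (hDo : IsOpen D) (hDc : IsPreconnected D)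
    {σ₀ : ℝ} (hσ₀ : 1 < σ₀) (hσD : ∀ᶠ z in 𝓝 ((σ₀ : ℝ) : ℂ), z ∈ D) (hD1 : ∀ᶠ z in 𝓝[≠] (1 : ℂ), z ∈ D)
    (hE2 : ∀ z ∈ D, 1 < z.re → Ec z = eisensteinSeriesU (flatSectionU (fun _ : (quasiSplit (↥(maximalRealSubfield L)) L (IsCMField.complexConj L) 2).Adelic => φ₀) z))
    (F : ℂ → (quasiSplit (↥(maximalRealSubfield L)) L (IsCMField.complexConj L) 2).L2 μ) (hFd : DifferentiableOn ℂ F D)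
    (hFam : ∀ z ∈ D, ((F z : (quasiSplit (↥(maximalRealSubfield L)) L (IsCMField.complexConj L) 2).L2 μ) : (quasiSplit (↥(maximalRealSubfield L)) L (IsCMField.complexConj L) 2).automorphicQuotient → ℂ) =ᵐ[μ]
      (quasiSplit (↥(maximalRealSubfield L)) L (IsCMField.complexConj L) 2).quotFun (truncation ν 𝓕 T (Ec z)))
    (Res : (quasiSplit (↥(maximalRealSubfield L)) L (IsCMField.complexConj L) 2).L2 μ) (hRes : Tendsto (fun z : ℂ => (z - 1) • F z) (𝓝[≠] 1) (𝓝 Res))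
    (ind : (quasiSplit (↥(maximalRealSubfield L)) L (IsCMField.complexConj L) 2).L2 μ)
    (hind : ∀ hm : MemLp ((quasiSplit (↥(maximalRealSubfield L)) L (IsCMField.complexConj L) 2).quotFun fun t =>
      if T < supHeight (↥(maximalRealSubfield L)) L (IsCMField.complexConj L) 2 ((quasiSplit (↥(maximalRealSubfield L)) L (IsCMField.complexConj L) 2).toAutomorphicQuotient t⁻¹) then (1 : ℂ) else 0) 2 μ,
      ind = hm.toLp _)
    (κ : ℂ) :
    ∀ φ : ↥((quasiSplit (↥(maximalRealSubfield L)) L (IsCMField.complexConj L) 2).cuspForms μ 𝔓),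
      ⟪Res + κ • ind, (quasiSplit (↥(maximalRealSubfield L)) L (IsCMField.complexConj L) 2).cuspFormsToLp μ 𝔓 φ⟫_ℂ = 0 := by
  intro φ
  set w := (quasiSplit (↥(maximalRealSubfield L)) L (IsCMField.complexConj L) 2).cuspFormsToLp μ 𝔓 φ with hw
  -- (1) the seed on a ball around the real tube point `σ₀`
  obtain ⟨ε, hε, hball⟩ := Metric.eventually_nhds_iff_ball.1 hσD
  have hσ₀D : ((σ₀ : ℝ) : ℂ) ∈ D := hball _ (Metric.mem_ball_self hε)
  have hseed : ∀ᶠ z in 𝓝 ((σ₀ : ℝ) : ℂ), ⟪w, F z⟫_ℂ = 0 := by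
    have hmem : Metric.ball ((σ₀ : ℝ) : ℂ) (min ε (σ₀ - 1)) ∈ 𝓝 ((σ₀ : ℝ) : ℂ) := Metric.ball_mem_nhds _ (lt_min hε (by linarith))
    filter_upwards [hmem] with z hz
    rw [Metric.mem_ball] at hz
    have hzD : z ∈ D := hball _ (Metric.mem_ball.2 (hz.trans_le (min_le_left _ _)))
    have hzre : |z.re - σ₀| < σ₀ - 1 := by
      have h1 : |z.re - σ₀| ≤ dist z ((σ₀ : ℝ) : ℂ) := by
        rw [Complex.dist_eq]
        have := Complex.abs_re_le_norm (z - ((σ₀ : ℝ) : ℂ))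
        simpa only [Complex.sub_re, Complex.ofReal_re] using this
      exact h1.trans_lt (hz.trans_le (min_le_right _ _))
    have hz2 : 1 < z.re := by
      have := (abs_lt.1 hzre).1; linarith
    have hzreD : ((z.re : ℝ) : ℂ) ∈ D := by
      refine hball _ (Metric.mem_ball.2 (lt_of_le_of_lt ?_ (hz.trans_le (min_le_left _ _))))
      rw [Complex.dist_eq, Complex.dist_eq, ← Complex.ofReal_sub, Complex.norm_real, Real.norm_eq_abs]
      have := Complex.abs_re_le_norm (z - ((σ₀ : ℝ) : ℂ))
      simpa only [Complex.sub_re, Complex.ofReal_re] using this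
    have hzre2 : 1 < (((z.re : ℝ) : ℂ)).re := by rwa [Complex.ofReal_re]
    have hv := (hFam z hzD).trans (by rw [hE2 z hzD hz2])
    have hL2 : MemLp ((quasiSplit (↥(maximalRealSubfield L)) L (IsCMField.complexConj L) 2).quotFun
        (truncation ν 𝓕 T (eisensteinSeriesU (flatSectionU (fun _ : (quasiSplit (↥(maximalRealSubfield L)) L (IsCMField.complexConj L) 2).Adelic => φ₀) ((z.re : ℝ) : ℂ))))) 2 μ := by
      rw [← hE2 _ hzreD hzre2]
      exact (Lp.memLp (F _)).ae_eq (hFam _ hzreD)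
    exact inner_cuspFormsToLp_eq_zero_of_ae_eq_truncation_cm_two L μ ν h𝓕N h𝓕c 𝔓 i h𝔓 φ₀ hT hz2 (F z) hv hL2 φ
  -- (2) identity principle on `D`
  have hD : ∀ z ∈ D, ⟪w, F z⟫_ℂ = 0 := inner_eq_zero_of_differentiableOn hDo hDc hFd w hσ₀D hseed
  -- (3) the Siegel indicator class
  have hind0 : ⟪w, ind⟫_ℂ = 0 := by
    have hm := memLp_quotFun_siegelIndicator (F := (↥(maximalRealSubfield L))) (E := L) (c := (IsCMField.complexConj L)) (N := 2) μ 2 T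
    rw [hind hm]
    exact inner_cuspFormsToLp_eq_zero_of_ae_eq_siegelIndicator_cm_two L μ ν h𝓕N h𝓕c 𝔓 i h𝔓 hT _ hm.coeFn_toLp φ
  -- (4) near `1`, `V z = (z−1)•F z + κ•ind` is orthogonal to `w`; (5) pass to the limit
  have hV : Tendsto (fun z : ℂ => (z - 1) • F z + κ • ind) (𝓝[≠] 1) (𝓝 (Res + κ • ind)) := hRes.add tendsto_const_nhds
  have h0 : ∀ᶠ z in 𝓝[≠] (1 : ℂ), ⟪w, (z - 1) • F z + κ • ind⟫_ℂ = 0 := by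
    filter_upwards [hD1] with z hz
    rw [inner_add_right, inner_smul_right, inner_smul_right, hD z hz, hind0, mul_zero, mul_zero, add_zero]
  exact inner_eq_zero_symm.1 (inner_eq_zero_of_tendsto w hV h0)

end Head

end Summit.HodgeConjecture.HodgeConjecture.Cruxes.H413.K2E1SphericalEisensteinResidueOrthogonalCMTwo

end
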